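import Summits.HodgeConjecture.HodgeConjecture.Theorems.R90S3SplitTransferTransport   -- ★ (this hand) `isLocalDeltaTransfer_finExplicit_transport_iff_formSignAt`, `finsum_delta_mul_classOrbitalIntegral_const_smul'`
import HarnessLib

/-!
# R90 · S3 — Prop. 4.9.1 (a) on `C_c^∞` transports along a local similitude frame AT EVERY FINITE PLACE (split places included)

R90-TF section S3 (dealer R90-C12-plan (g0)), hand p06 «A1-split», companion of `Theorems/R90S3SplitTransferTransport` (R-i): the tree's
`Lines/R90_S3_CharIdTransportB` §2 `isLocalDeltaTransferExists_finExplicit_transport_iff` feeds socket A1's transfer-existence hypothesis `hT` at the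
quasi-split form `Φ₃` from the consumer's transfer existence at the inner form `H`, under the NON-SPLIT guard `hv`.  Here the same transport at EVERY finite
place, with the form sign `ε_v(H) = formSignAt L c H v` (`= 1` at a split place): `isLocalDeltaTransferExists_finExplicit_transport_iff_formSignAt` — push test
functions through `e_v^{±1}` (★ `isLocalDeltaTransfer_finExplicit_transport_iff_formSignAt`; `ε_v(H)·f^H` is smooth, `ε_v(H)² = 1`).  Imports ★ only (R-S3-1).
HONEST LABEL: transport book-keeping — nothing printed in Ch. 13 is proved here; HC_CM is proved only modulo the 7 printed citations (2 remaining named inputs: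
hLiu418 = stmt-HodgeConjecture-24832, h413 = stmt-HodgeConjecture-24833) until rung 0 closes; REL ≠ ★ ≠ BUILT.
-/

set_option autoImplicit false
set_option linter.dupNamespace false

noncomputable section

namespace Summit.HodgeConjecture.HodgeConjecture.R90.S3

open MeasureTheory IsDedekindDomain NumberField Matrix
open Literature.NumberTheory Literature.NumberTheory.Automorphic Literature.NumberTheory.Automorphic.UnitaryGroup
open Literature.NumberTheory.Rogawski1990 Literature.NumberTheory.GaloisRepresentations
open scoped MatrixGroups

variable (L : Type) [Field L] [NumberField L] [IsCMField L] (v : HeightOneSpectrum (𝓞 ↥(maximalRealSubfield L)))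
  (H : Matrix (Fin 3) (Fin 3) L) (T : GL (Fin 3) (UnitaryGroup.LocalRing L v)) {a : UnitaryGroup.LocalRing L v} (ha : IsUnit a)
  (h : formCongr (UnitaryGroup.conjLocal L (IsCMField.complexConj L) v) T (H.map (algebraMap L (UnitaryGroup.LocalRing L v))) =
    a • (Matrix.of fun i j : Fin 3 => if i.val + j.val + 1 = 3 then (1 : L) else 0).map (algebraMap L (UnitaryGroup.LocalRing L v)))

/-! ## §1 Smoothness along the frame; signs across a matching -/

/-- `g ∈ C_c^∞(U(H)_v) ⇒ g ∘ e_v ∈ C_c^∞(U(Φ₃)_v)`. [cite: Rogawski1990, §14.4 p. 237; §1.6 p. 6] -/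
theorem isLocSmooth_comp_cmDatumLocalCongr {g : (UnitaryGroup.cmDatum L 3 H).Local v → ℂ} (hg : IsLocSmooth g) :
    IsLocSmooth (g ∘ UnitaryGroup.cmDatumLocalCongr L v T ha h) :=
  ⟨hg.1.comp_continuous (UnitaryGroup.cmDatumLocalCongr L v T ha h).continuous,
    hg.2.comp_homeomorph (UnitaryGroup.cmDatumLocalCongr L v T ha h).toHomeomorph⟩

/-- `f ∈ C_c^∞(U(Φ₃)_v) ⇒ f ∘ e_v⁻¹ ∈ C_c^∞(U(H)_v)`. [cite: Rogawski1990, §14.4 p. 237; §1.6 p. 6] -/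
theorem isLocSmooth_comp_cmDatumLocalCongr_symm {f : (UnitaryGroup.cmDatum L 3 (Matrix.of fun i j : Fin 3 => if i.val + j.val + 1 = 3 then (1 : L) else 0)).Local v → ℂ}
    (hf : IsLocSmooth f) : IsLocSmooth (f ∘ (UnitaryGroup.cmDatumLocalCongr L v T ha h).symm) :=
  ⟨hf.1.comp_continuous (UnitaryGroup.cmDatumLocalCongr L v T ha h).symm.continuous,
    hf.2.comp_homeomorph (UnitaryGroup.cmDatumLocalCongr L v T ha h).symm.toHomeomorph⟩

/-- **Moving a sign across a matching**: `(f^H, z•f)` `Δ`-matched and `z² = 1` ⇒ `(z•f^H, f)` `Δ`-matched. [cite: Rogawski1990, §4.3 (4.3.1) p. 43] -/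
theorem isLocalDeltaTransfer_smul_of_smul' {X : Matrix (Fin 3) (Fin 3) L}
    [∀ γH : (UnitaryGroup.cmDatum L 2 (Matrix.of fun i j : Fin 2 => if i.val + j.val + 1 = 2 then (1 : L) else 0)).Local v ×
        (UnitaryGroup.cmDatum L 1 (Matrix.of fun i j : Fin 1 => if i.val + j.val + 1 = 1 then (1 : L) else 0)).Local v,
      MeasurableSpace (((UnitaryGroup.cmDatum L 2 (Matrix.of fun i j : Fin 2 => if i.val + j.val + 1 = 2 then (1 : L) else 0)).Local v ×
        (UnitaryGroup.cmDatum L 1 (Matrix.of fun i j : Fin 1 => if i.val + j.val + 1 = 1 then (1 : L) else 0)).Local v) ⧸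
        Subgroup.centralizer ({γH} : Set ((UnitaryGroup.cmDatum L 2 (Matrix.of fun i j : Fin 2 => if i.val + j.val + 1 = 2 then (1 : L) else 0)).Local v ×
        (UnitaryGroup.cmDatum L 1 (Matrix.of fun i j : Fin 1 => if i.val + j.val + 1 = 1 then (1 : L) else 0)).Local v)))]
    [∀ γ : (UnitaryGroup.cmDatum L 3 X).Local v, MeasurableSpace ((UnitaryGroup.cmDatum L 3 X).Local v ⧸ Subgroup.centralizer ({γ} : Set ((UnitaryGroup.cmDatum L 3 X).Local v)))]
    (Δ : LocalTransferFactor L X v)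
    (mH : OrbitalMeasureFamily ((UnitaryGroup.cmDatum L 2 (Matrix.of fun i j : Fin 2 => if i.val + j.val + 1 = 2 then (1 : L) else 0)).Local v ×
      (UnitaryGroup.cmDatum L 1 (Matrix.of fun i j : Fin 1 => if i.val + j.val + 1 = 1 then (1 : L) else 0)).Local v))
    (mG : OrbitalMeasureFamily ((UnitaryGroup.cmDatum L 3 X).Local v)) {z : ℂ} (hz : z * z = 1)
    {fH : (UnitaryGroup.cmDatum L 2 (Matrix.of fun i j : Fin 2 => if i.val + j.val + 1 = 2 then (1 : L) else 0)).Local v ×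
      (UnitaryGroup.cmDatum L 1 (Matrix.of fun i j : Fin 1 => if i.val + j.val + 1 = 1 then (1 : L) else 0)).Local v → ℂ}
    {f : (UnitaryGroup.cmDatum L 3 X).Local v → ℂ} (ht : IsLocalDeltaTransfer L X v Δ mH mG fH (z • f)) :
    IsLocalDeltaTransfer L X v Δ mH mG (z • fH) f := by
  intro γH hreg
  rw [stableOrbitalIntegralRel_smul_fun, ht γH hreg, finsum_delta_mul_classOrbitalIntegral_const_smul', ← mul_assoc, hz, one_mul]

/-- **Scaling a matching**: `(f^H, f)` `Δ`-matched ⇒ `(z•f^H, z•f)` `Δ`-matched. [cite: Rogawski1990, §4.3 (4.3.1) p. 43] -/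
theorem isLocalDeltaTransfer_smul_smul' {X : Matrix (Fin 3) (Fin 3) L}
    [∀ γH : (UnitaryGroup.cmDatum L 2 (Matrix.of fun i j : Fin 2 => if i.val + j.val + 1 = 2 then (1 : L) else 0)).Local v ×
        (UnitaryGroup.cmDatum L 1 (Matrix.of fun i j : Fin 1 => if i.val + j.val + 1 = 1 then (1 : L) else 0)).Local v,
      MeasurableSpace (((UnitaryGroup.cmDatum L 2 (Matrix.of fun i j : Fin 2 => if i.val + j.val + 1 = 2 then (1 : L) else 0)).Local v ×
        (UnitaryGroup.cmDatum L 1 (Matrix.of fun i j : Fin 1 => if i.val + j.val + 1 = 1 then (1 : L) else 0)).Local v) ⧸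
        Subgroup.centralizer ({γH} : Set ((UnitaryGroup.cmDatum L 2 (Matrix.of fun i j : Fin 2 => if i.val + j.val + 1 = 2 then (1 : L) else 0)).Local v ×
        (UnitaryGroup.cmDatum L 1 (Matrix.of fun i j : Fin 1 => if i.val + j.val + 1 = 1 then (1 : L) else 0)).Local v)))]
    [∀ γ : (UnitaryGroup.cmDatum L 3 X).Local v, MeasurableSpace ((UnitaryGroup.cmDatum L 3 X).Local v ⧸ Subgroup.centralizer ({γ} : Set ((UnitaryGroup.cmDatum L 3 X).Local v)))]
    (Δ : LocalTransferFactor L X v)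
    (mH : OrbitalMeasureFamily ((UnitaryGroup.cmDatum L 2 (Matrix.of fun i j : Fin 2 => if i.val + j.val + 1 = 2 then (1 : L) else 0)).Local v ×
      (UnitaryGroup.cmDatum L 1 (Matrix.of fun i j : Fin 1 => if i.val + j.val + 1 = 1 then (1 : L) else 0)).Local v))
    (mG : OrbitalMeasureFamily ((UnitaryGroup.cmDatum L 3 X).Local v)) (z : ℂ)
    {fH : (UnitaryGroup.cmDatum L 2 (Matrix.of fun i j : Fin 2 => if i.val + j.val + 1 = 2 then (1 : L) else 0)).Local v ×
      (UnitaryGroup.cmDatum L 1 (Matrix.of fun i j : Fin 1 => if i.val + j.val + 1 = 1 then (1 : L) else 0)).Local v → ℂ}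
    {f : (UnitaryGroup.cmDatum L 3 X).Local v → ℂ} (ht : IsLocalDeltaTransfer L X v Δ mH mG fH f) :
    IsLocalDeltaTransfer L X v Δ mH mG (z • fH) (z • f) := by
  intro γH hreg
  rw [stableOrbitalIntegralRel_smul_fun, ht γH hreg, finsum_delta_mul_classOrbitalIntegral_const_smul']

/-! ## §2 Prop. 4.9.1 (a) on `C_c^∞` transports along the frame — every finite place -/

section Exists

variable [∀ γH : (UnitaryGroup.cmDatum L 2 (Matrix.of fun i j : Fin 2 => if i.val + j.val + 1 = 2 then (1 : L) else 0)).Local v ×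
      (UnitaryGroup.cmDatum L 1 (Matrix.of fun i j : Fin 1 => if i.val + j.val + 1 = 1 then (1 : L) else 0)).Local v,
    MeasurableSpace (((UnitaryGroup.cmDatum L 2 (Matrix.of fun i j : Fin 2 => if i.val + j.val + 1 = 2 then (1 : L) else 0)).Local v ×
      (UnitaryGroup.cmDatum L 1 (Matrix.of fun i j : Fin 1 => if i.val + j.val + 1 = 1 then (1 : L) else 0)).Local v) ⧸
      Subgroup.centralizer ({γH} : Set ((UnitaryGroup.cmDatum L 2 (Matrix.of fun i j : Fin 2 => if i.val + j.val + 1 = 2 then (1 : L) else 0)).Local v ×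
      (UnitaryGroup.cmDatum L 1 (Matrix.of fun i j : Fin 1 => if i.val + j.val + 1 = 1 then (1 : L) else 0)).Local v)))]
  [∀ γ : (UnitaryGroup.cmDatum L 3 H).Local v,
    MeasurableSpace ((UnitaryGroup.cmDatum L 3 H).Local v ⧸ Subgroup.centralizer ({γ} : Set ((UnitaryGroup.cmDatum L 3 H).Local v)))]
  [∀ γ : (UnitaryGroup.cmDatum L 3 H).Local v,
    BorelSpace ((UnitaryGroup.cmDatum L 3 H).Local v ⧸ Subgroup.centralizer ({γ} : Set ((UnitaryGroup.cmDatum L 3 H).Local v)))]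
  [∀ γ : (UnitaryGroup.cmDatum L 3 (Matrix.of fun i j : Fin 3 => if i.val + j.val + 1 = 3 then (1 : L) else 0)).Local v,
    MeasurableSpace ((UnitaryGroup.cmDatum L 3 (Matrix.of fun i j : Fin 3 => if i.val + j.val + 1 = 3 then (1 : L) else 0)).Local v ⧸
      Subgroup.centralizer ({γ} : Set ((UnitaryGroup.cmDatum L 3 (Matrix.of fun i j : Fin 3 => if i.val + j.val + 1 = 3 then (1 : L) else 0)).Local v)))]
  [∀ γ : (UnitaryGroup.cmDatum L 3 (Matrix.of fun i j : Fin 3 => if i.val + j.val + 1 = 3 then (1 : L) else 0)).Local v,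
    BorelSpace ((UnitaryGroup.cmDatum L 3 (Matrix.of fun i j : Fin 3 => if i.val + j.val + 1 = 3 then (1 : L) else 0)).Local v ⧸
      Subgroup.centralizer ({γ} : Set ((UnitaryGroup.cmDatum L 3 (Matrix.of fun i j : Fin 3 => if i.val + j.val + 1 = 3 then (1 : L) else 0)).Local v)))]

/-- **PROP. 4.9.1 (a) ON `C_c^∞` TRANSPORTS ALONG `e_v` — EVERY FINITE PLACE** [§14.4 p. 237]: local `Δ‴^{H}`-transfer exists for smooth test functions on `U(H)_v`
(family `m′_G`) iff local `Δ‴^{Φ₃}`-transfer exists for smooth test functions on `U(Φ₃)_v` (family `(e_v⁻¹)_* m′_G`) — push test functions through `e_v^{±1}`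
(§6; `ε_v(H)·f^H` is smooth, `ε_v(H)² = 1`).  Feeds A1's `hT` at `Φ₃` from the consumer's transfer existence at `H`, split places included.
[cite: Rogawski1990, §4.9 Prop. 4.9.1 (a) p. 55; §14.4 p. 237] -/
theorem isLocalDeltaTransferExists_finExplicit_transport_iff_formSignAt (hH : (H.map (cmConjRingHom L))ᵀ = H) (hHd : IsUnit H.det) (μ : HeckeCharacter L)
    (mH : OrbitalMeasureFamily ((UnitaryGroup.cmDatum L 2 (Matrix.of fun i j : Fin 2 => if i.val + j.val + 1 = 2 then (1 : L) else 0)).Local v ×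
      (UnitaryGroup.cmDatum L 1 (Matrix.of fun i j : Fin 1 => if i.val + j.val + 1 = 1 then (1 : L) else 0)).Local v))
    (mG : OrbitalMeasureFamily ((UnitaryGroup.cmDatum L 3 H).Local v)) :
    IsLocalDeltaTransferExists L H v (finExplicitCollection L H μ (finExplicitDelta_conj_left_all L H μ) (finExplicitDelta_conj_right_all L H μ) v) mH mG
        IsLocSmooth IsLocSmooth ↔
      IsLocalDeltaTransferExists L (Matrix.of fun i j : Fin 3 => if i.val + j.val + 1 = 3 then (1 : L) else 0) v
        (finExplicitCollection L (Matrix.of fun i j : Fin 3 => if i.val + j.val + 1 = 3 then (1 : L) else 0) μ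
          (finExplicitDelta_conj_left_all L _ μ) (finExplicitDelta_conj_right_all L _ μ) v) mH
        (mG.transport (UnitaryGroup.cmDatumLocalCongr L v T ha h).symm.toMulEquiv (UnitaryGroup.cmDatumLocalCongr L v T ha h).symm.continuous
          (UnitaryGroup.cmDatumLocalCongr L v T ha h).continuous) IsLocSmooth IsLocSmooth := by
  set ε : ℂ := ((formSignAt L (IsCMField.complexConj L) H v : ℤ) : ℂ) with hε
  have hε2 : ε * ε = 1 := intCast_formSignAt_mul_self L H v
  constructor
  · intro hT f hf
    -- `g := f ∘ e_v⁻¹` on `U(H)_v`; transfer it at `H`; push back with §6 and move the sign to the `H`-side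
    obtain ⟨fH, hfH, ht⟩ := hT (f ∘ (UnitaryGroup.cmDatumLocalCongr L v T ha h).symm) (isLocSmooth_comp_cmDatumLocalCongr_symm L v H T ha h hf)
    refine ⟨ε • fH, hfH.const_smul ε, ?_⟩
    have ht' := (isLocalDeltaTransfer_finExplicit_transport_iff_formSignAt L v H T ha h hH hHd μ mH mG fH _).1 ht
    have hfe : (f ∘ (UnitaryGroup.cmDatumLocalCongr L v T ha h).symm) ∘ (UnitaryGroup.cmDatumLocalCongr L v T ha h) = f := by
      funext b; simp
    rw [hfe] at ht'
    exact isLocalDeltaTransfer_smul_of_smul' L v _ mH _ hε2 ht'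
  · intro hT g hg
    obtain ⟨fH, hfH, ht⟩ := hT (g ∘ UnitaryGroup.cmDatumLocalCongr L v T ha h) (isLocSmooth_comp_cmDatumLocalCongr L v H T ha h hg)
    refine ⟨ε • fH, hfH.const_smul ε, ?_⟩
    exact (isLocalDeltaTransfer_finExplicit_transport_iff_formSignAt L v H T ha h hH hHd μ mH mG (ε • fH) g).2
      (isLocalDeltaTransfer_smul_smul' L v _ mH _ ε ht)

end Exists

end Summit.HodgeConjecture.HodgeConjecture.R90.S3

end
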